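import Literature.NumberTheory.Automorphic.EichlerMassFormula
import Literature.NumberTheory.Automorphic.DefiniteMaximalOrdersUnitIndexClasses
import Literature.NumberTheory.Automorphic.DefiniteMaximalOrdersClassNumberOneConverse
import HarnessLib

/-!
# Class numbers of definite quaternion orders over `ℚ`, unconditionally: the mass of a Brandt
# setup, Voight's Thm. 25.4.1 as an iff, Eichler's class number formula for prime discriminant

Topic `NumberTheory/Automorphic`; theorems only (no definition, no named fact, no instance).
With Eichler's mass formula now a theorem of the tree (`brandtModule_massFormula_holds`,
`EichlerMassFormula.lean`), the results of `DefiniteMaximalOrdersClassNumberOneConverse.lean`,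
`DefiniteMaximalOrdersEichlerClassNumber.lean` and `DefiniteMaximalOrdersUnitIndexClasses.lean`
that carried the hypothesis `(hmass : brandtModule_massFormula)` hold unconditionally. This file
records them in that form, in the `Brandt.XiSetup` dot-notation:

* `Brandt.XiSetup.massFormula` — **`∑_c 1/w_c = (1/12) ∏_{q ∣ N⁻} (q-1) ∏_{p^k ∥ N⁺} p^{k-1}(p+1)`**
  for every Brandt setup of type `(N⁺, N⁻)` (Voight Thm. 25.3.18); `brandtModule_sum_inv_w_eq` —
  the same for `brandtModule N⁺ N⁻` at admissible levels; `Brandt.XiSetup.sum_inv_weight_eq_of_prime'`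
  (`(p-1)/12` at level `(1, p)`), `Brandt.XiSetup.inv_unitIndex_eq_mass` (one class).
* `Brandt.XiSetup.natCard_classSet_eq_one_iff` — **Voight Thm. 25.4.1**: a maximal order of the
  definite quaternion algebra of discriminant `D` has class number one iff `D ∈ {2, 3, 5, 7, 13}`;
  `EichlerPackage.classNumber_eq_one_iff`; `Brandt.XiSetup.two_le_natCard_classSet_fortyTwo`
  (Voight Exercise 25.5 (e): `D = 42` has at least two classes).
* `Brandt.XiSetup.natCard_classSet_eq_rho`, `Brandt.XiSetup.natCard_classSet_eq_legendreSym` —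
  **Eichler's class number formula for prime discriminant**
  `h = (p-1)/12 + (1 - (-4/p))/4 + (1 - (-3/p))/3` (Voight Thm. 30.1.5 at `(D, M) = (p, 1)`,
  Vignéras V Prop. 3.2); `Brandt.XiSetup.twelve_mul_natCard_classSet_add` (its `ℕ`-form
  `12 h + 3 ρ_p(0,1) + 4 ρ_p(1,1) = p + 13`); the value lists `natCard_classSet_eq_one_iff_of_prime`
  (`h = 1 ⟺ p ∈ {2,3,5,7,13}`), `natCard_classSet_eq_two_iff` (`h = 2 ⟺ p ∈ {11,17,19}`),
  `natCard_classSet_eq_three_iff` (`h = 3 ⟺ p ∈ {23,29,31,37}`), and the concrete class numbers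
  `natCard_classSet_eleven / _seventeen / _nineteen = 2`, `natCard_classSet_twentyThree = 3`;
  `Brandt.XiSetup.natCard_classSet_eq_of_mod_twelve` — **Voight Exercise 30.6**: `h` by `p mod 12`;
  `Brandt.XiSetup.natCard_weight_eq_one` — the number of classes of weight one.

## References

* J. Voight, *Quaternion Algebras*, GTM 288 (2021), Thm. 25.3.18, Thm. 25.4.1, Exercise 25.5,
  Thm. 30.1.5, Exercise 30.6 [Voight2021].
* M.-F. Vignéras, *Arithmétique des algèbres de quaternions*, LNM 800 (1980), Ch. V §2 Cor. 2.3,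
  §3 Prop. 3.2 [VignerasLNM800].
-/

noncomputable section

open Finset
open Literature.NumberTheory.Automorphic.Brandt
open Literature.NumberTheory.Automorphic.HeckeTraceFormulaGL2Level

namespace Literature.NumberTheory.Automorphic

/-! ### The mass of a Brandt setup and of the Brandt module -/

section Mass

variable {Nplus Nminus : ℕ}

/-- **Eichler's mass formula for a Brandt setup of type `(N⁺, N⁻)`**:
`∑_c 1/w_c = (1/12) ∏_{q ∣ N⁻} (q - 1) ∏_{p^k ∥ N⁺} p^{k-1} (p + 1)`, the weights `w_c = #O_L(I_c)ˣ/2`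
of `BrandtXi.lean` (transported from `brandtModule_massFormula_holds` through the dictionary
`ClassSet S.O ≃ Cls O`). [cite: Voight2021, Thm. 25.3.18] [cite: VignerasLNM800, Ch. V §2 Cor. 2.3] -/
theorem Brandt.XiSetup.massFormula (S : XiSetup Nplus Nminus) [Fintype (ClassSet S.O)] :
    ∑ c, (1 : ℚ) / weight S.O c =
      (1 / 12 : ℚ) * (∏ q ∈ Nminus.primeFactors, ((q : ℚ) - 1)) *
        ∏ p ∈ Nplus.primeFactors, (p : ℚ) ^ (Nplus.factorization p - 1) * ((p : ℚ) + 1) := by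
  classical
  have h := brandtModule_massFormula_holds Nplus Nminus S.toEichlerPackage S.nplus_pos S.squarefree
  have hO : IsZOrder S.O := S.toEichlerPackage.isEichlerOrder.isZOrder
  have hri : rightIdeals S.O = invertibleRightIdeals S.O :=
    rightIdeals_eq_invertibleRightIdeals_of_isTotallyDefinite S.isTotallyDefinite hO
  let e : ClassSet S.O ≃ S.toEichlerPackage.brandtData.ι := ClassSet.equivRightIdealClass hri
  have hsum : ∑ i : S.toEichlerPackage.brandtData.ι, (1 : ℚ) / S.toEichlerPackage.brandtData.w i =
      ∑ c : ClassSet S.O, (1 : ℚ) / weight S.O c := by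
    rw [← Fintype.sum_equiv e (fun c => (1 : ℚ) / weight S.O c)
      (fun j => (1 : ℚ) / S.toEichlerPackage.brandtData.w j)
      (fun c => by rw [show S.toEichlerPackage.brandtData.w (e c) = weight S.O c from
        BrandtData.ofOrder_w_equivRightIdealClass hO hri c])]
  rw [← hsum, h]

/-- **The mass of the Brandt module of level `(N⁺, N⁻)`** at an admissible level (`N⁺ ≥ 1`,
`N⁻` squarefree with an odd number of prime factors, `gcd(N⁺, N⁻) = 1`):
`∑_i 1/w_i = (1/12) ∏_{q ∣ N⁻} (q - 1) ∏_{p^k ∥ N⁺} p^{k-1} (p + 1)` (existence of the Eichler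
package: `nonempty_eichlerPackage_holds`). [cite: Voight2021, Thm. 25.3.18] -/
theorem brandtModule_sum_inv_w_eq (h0 : 0 < Nplus) (hsq : Squarefree Nminus)
    (hodd : Odd Nminus.primeFactors.card) (hcop : Nat.Coprime Nplus Nminus) :
    ∑ i : (brandtModule Nplus Nminus).ι, (1 : ℚ) / (brandtModule Nplus Nminus).w i =
      (1 / 12 : ℚ) * (∏ q ∈ Nminus.primeFactors, ((q : ℚ) - 1)) *
        ∏ p ∈ Nplus.primeFactors, (p : ℚ) ^ (Nplus.factorization p - 1) * ((p : ℚ) + 1) := by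
  rw [brandtModule_eq_of_admissible nonempty_eichlerPackage_holds h0 hsq hodd hcop]
  exact brandtModule_massFormula_holds Nplus Nminus _ h0 hsq

/-- **`∑_c 1/w_c = (p - 1)/12` at level `(1, p)`**, `p` prime (Voight Thm. 25.1.1 / 25.3.15), now
unconditional. [cite: Voight2021, Thm. 25.3.15] -/
theorem Brandt.XiSetup.sum_inv_weight_eq_of_prime' {p : ℕ} (hp : p.Prime) (S : XiSetup 1 p)
    [Fintype (ClassSet S.O)] : ∑ c, (1 : ℚ) / weight S.O c = ((p : ℚ) - 1) / 12 :=
  xiSetup_sum_inv_weight_eq_of_prime brandtModule_massFormula_holds hp S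

/-- **One class ⟹ `1/w(O) = mass`**: for a Brandt setup with a single ideal class,
`1/[Oˣ : ±1] = (1/12) ∏_{q ∣ N⁻} (q-1) ∏_{p^k ∥ N⁺} p^{k-1}(p+1)`. [cite: Voight2021, Exercise 25.5 (b)] -/
theorem Brandt.XiSetup.inv_unitIndex_eq_mass (S : XiSetup Nplus Nminus) [Subsingleton (ClassSet S.O)] :
    (1 : ℚ) / unitIndex S.O =
      (1 / 12 : ℚ) * (∏ q ∈ Nminus.primeFactors, ((q : ℚ) - 1)) *
        ∏ p ∈ Nplus.primeFactors, (p : ℚ) ^ (Nplus.factorization p - 1) * ((p : ℚ) + 1) :=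
  xiSetup_inv_unitIndex_eq_mass brandtModule_massFormula_holds S

/-- For a maximal order with one class, `w(O) · φ(N⁻) = 12`. [cite: Voight2021, Exercise 25.5 (b)–(c)] -/
theorem Brandt.XiSetup.unitIndex_mul_totient_eq_twelve (S : XiSetup 1 Nminus)
    [Subsingleton (ClassSet S.O)] : unitIndex S.O * ∏ q ∈ Nminus.primeFactors, (q - 1) = 12 :=
  xiSetup_unitIndex_mul_totient_eq_twelve brandtModule_massFormula_holds S

end Mass

/-! ### Voight's Theorem 25.4.1, both directions -/

section ClassNumberOne

variable {Nminus : ℕ}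

/-- **Voight Thm. 25.4.1** (class number one for definite maximal orders over `ℚ`): for a Brandt
setup of type `(1, D)` — a maximal order of the definite quaternion algebra of discriminant `D` —
`# Cls O = 1 ⟺ D ∈ {2, 3, 5, 7, 13}`. [cite: Voight2021, Thm. 25.4.1] [cite: VignerasLNM800, Ch. V §3 (table of class number one)] -/
theorem Brandt.XiSetup.natCard_classSet_eq_one_iff (S : XiSetup 1 Nminus) :
    Nat.card (ClassSet S.O) = 1 ↔ (Nminus = 2 ∨ Nminus = 3 ∨ Nminus = 5 ∨ Nminus = 7 ∨ Nminus = 13) :=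
  xiSetup_natCard_classSet_eq_one_iff brandtModule_massFormula_holds S

/-- **Voight Thm. 25.4.1 for Eichler packages of level `(1, N⁻)`**, `N⁻` squarefree:
class number one iff `N⁻ ∈ {2, 3, 5, 7, 13}`. [cite: Voight2021, Thm. 25.4.1] -/
theorem EichlerPackage.classNumber_eq_one_iff (P : EichlerPackage 1 Nminus) (hsq : Squarefree Nminus) :
    P.brandtData.classNumber = 1 ↔ (Nminus = 2 ∨ Nminus = 3 ∨ Nminus = 5 ∨ Nminus = 7 ∨ Nminus = 13) :=
  eichlerPackage_classNumber_eq_one_iff brandtModule_massFormula_holds P hsq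

/-- **`D = 42` has at least two ideal classes** (Voight Exercise 25.5 (e); in fact exactly two). [cite: Voight2021, Exercise 25.5 (e)] -/
theorem Brandt.XiSetup.two_le_natCard_classSet_fortyTwo (S : XiSetup 1 42) :
    2 ≤ Nat.card (ClassSet S.O) :=
  xiSetup_two_le_natCard_classSet_fortyTwo brandtModule_massFormula_holds S

end ClassNumberOne

/-! ### Eichler's class number formula for prime discriminant -/

section Prime

variable {p : ℕ}

/-- **Eichler's class number formula for prime discriminant, `ρ`-form**: for a maximal order `O`
of the definite quaternion algebra of prime discriminant `p`,
`# Cls O = (p-1)/12 + (2 - ρ_p(0,1))/4 + (2 - ρ_p(1,1))/3`. [cite: Voight2021, Thm. 30.1.5] [cite: VignerasLNM800, Ch. V §3 Prop. 3.2] -/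
theorem Brandt.XiSetup.natCard_classSet_eq_rho (hp : p.Prime) (S : XiSetup 1 p) :
    (Nat.card (ClassSet S.O) : ℚ) =
      ((p : ℚ) - 1) / 12 + (2 - (rho p 0 1 : ℚ)) / 4 + (2 - (rho p 1 1 : ℚ)) / 3 :=
  xiSetup_natCard_classSet_eq_rho brandtModule_massFormula_holds hp S

/-- **Eichler's class number formula for prime discriminant** `p ≠ 2`:
`# Cls O = (p-1)/12 + (1 - (-4/p))/4 + (1 - (-3/p))/3`. [cite: Voight2021, Thm. 30.1.5] [cite: VignerasLNM800, Ch. V §3 Prop. 3.2] -/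
theorem Brandt.XiSetup.natCard_classSet_eq_legendreSym [Fact p.Prime] (hp2 : p ≠ 2) (S : XiSetup 1 p) :
    (Nat.card (ClassSet S.O) : ℚ) =
      ((p : ℚ) - 1) / 12 + (1 - (legendreSym p (-4) : ℚ)) / 4 + (1 - (legendreSym p (-3) : ℚ)) / 3 :=
  xiSetup_natCard_classSet_eq_legendreSym brandtModule_massFormula_holds hp2 S

/-- The `ℕ`-form of Eichler's class number formula: `12 h + 3 ρ_p(0,1) + 4 ρ_p(1,1) = p + 13`. [cite: Voight2021, Thm. 30.1.5] -/
theorem Brandt.XiSetup.twelve_mul_natCard_classSet_add (hp : p.Prime) (S : XiSetup 1 p) :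
    12 * Nat.card (ClassSet S.O) + 3 * rho p 0 1 + 4 * rho p 1 1 = p + 13 :=
  xiSetup_twelve_mul_natCard_classSet_add brandtModule_massFormula_holds hp S

/-- **Class number one, prime discriminant**: `# Cls O = 1 ⟺ p ∈ {2, 3, 5, 7, 13}`. [cite: Voight2021, Thm. 25.4.1] -/
theorem Brandt.XiSetup.natCard_classSet_eq_one_iff_of_prime (hp : p.Prime) (S : XiSetup 1 p) :
    Nat.card (ClassSet S.O) = 1 ↔ (p = 2 ∨ p = 3 ∨ p = 5 ∨ p = 7 ∨ p = 13) :=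
  xiSetup_natCard_classSet_eq_one_iff_of_prime brandtModule_massFormula_holds hp S

/-- **Class number two, prime discriminant**: `# Cls O = 2 ⟺ p ∈ {11, 17, 19}`. [cite: Voight2021, Exercise 30.6 and Thm. 30.1.5] -/
theorem Brandt.XiSetup.natCard_classSet_eq_two_iff (hp : p.Prime) (S : XiSetup 1 p) :
    Nat.card (ClassSet S.O) = 2 ↔ (p = 11 ∨ p = 17 ∨ p = 19) :=
  xiSetup_natCard_classSet_eq_two_iff brandtModule_massFormula_holds hp S

/-- **Class number three, prime discriminant**: `# Cls O = 3 ⟺ p ∈ {23, 29, 31, 37}`. [cite: Voight2021, Exercise 30.6 and Thm. 30.1.5] -/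
theorem Brandt.XiSetup.natCard_classSet_eq_three_iff (hp : p.Prime) (S : XiSetup 1 p) :
    Nat.card (ClassSet S.O) = 3 ↔ (p = 23 ∨ p = 29 ∨ p = 31 ∨ p = 37) :=
  xiSetup_natCard_classSet_eq_three_iff brandtModule_massFormula_holds hp S

/-- The maximal orders of the definite quaternion algebra of discriminant `11` have exactly two
ideal classes. [cite: Voight2021, Exercise 30.6] -/
theorem Brandt.XiSetup.natCard_classSet_eleven (S : XiSetup 1 11) : Nat.card (ClassSet S.O) = 2 :=
  (Brandt.XiSetup.natCard_classSet_eq_two_iff (by norm_num) S).mpr (Or.inl rfl)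

/-- Discriminant `17`: exactly two ideal classes. [cite: Voight2021, Exercise 30.6] -/
theorem Brandt.XiSetup.natCard_classSet_seventeen (S : XiSetup 1 17) : Nat.card (ClassSet S.O) = 2 :=
  (Brandt.XiSetup.natCard_classSet_eq_two_iff (by norm_num) S).mpr (Or.inr (Or.inl rfl))

/-- Discriminant `19`: exactly two ideal classes. [cite: Voight2021, Exercise 30.6] -/
theorem Brandt.XiSetup.natCard_classSet_nineteen (S : XiSetup 1 19) : Nat.card (ClassSet S.O) = 2 :=
  (Brandt.XiSetup.natCard_classSet_eq_two_iff (by norm_num) S).mpr (Or.inr (Or.inr rfl))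

/-- Discriminant `23`: exactly three ideal classes. [cite: Voight2021, Exercise 30.6] -/
theorem Brandt.XiSetup.natCard_classSet_twentyThree (S : XiSetup 1 23) : Nat.card (ClassSet S.O) = 3 :=
  (Brandt.XiSetup.natCard_classSet_eq_three_iff (by norm_num) S).mpr (Or.inl rfl)

/-- **Voight Exercise 30.6** — the class number of a maximal order of prime discriminant `p` by
the residue of `p mod 12`: `1` for `p = 2, 3`; `(p-1)/12`, `(p+7)/12`, `(p+5)/12`, `(p+13)/12`
for `p ≡ 1, 5, 7, 11 (mod 12)`. [cite: Voight2021, Exercise 30.6] -/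
theorem Brandt.XiSetup.natCard_classSet_eq_of_mod_twelve (hp : p.Prime) (S : XiSetup 1 p) :
    Nat.card (ClassSet S.O) =
      if p = 2 ∨ p = 3 then 1
      else if p % 12 = 1 then (p - 1) / 12 else if p % 12 = 5 then (p + 7) / 12
      else if p % 12 = 7 then (p + 5) / 12 else (p + 13) / 12 :=
  xiSetup_natCard_classSet_eq_of_mod_twelve brandtModule_massFormula_holds hp S

/-- `12 · # Cls O` by the residue of `p mod 12` (`p ≠ 2, 3`). [cite: Voight2021, Exercise 30.6] -/
theorem Brandt.XiSetup.twelve_mul_natCard_classSet_eq_of_mod_twelve (hp : p.Prime) (hp2 : p ≠ 2)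
    (hp3 : p ≠ 3) (S : XiSetup 1 p) :
    12 * Nat.card (ClassSet S.O) =
      if p % 12 = 1 then p - 1 else if p % 12 = 5 then p + 7 else if p % 12 = 7 then p + 5 else p + 13 :=
  xiSetup_twelve_mul_natCard_classSet_eq_of_mod_twelve brandtModule_massFormula_holds hp hp2 hp3 S

/-- **The number of classes of weight one** (`p ≠ 2, 3`):
`#{c : w_c = 1} = (p-1)/12 - (2 - ρ_p(0,1))/4 - (2 - ρ_p(1,1))/6`. [cite: VignerasLNM800, Ch. V §3 Prop. 3.2] -/
theorem Brandt.XiSetup.natCard_weight_eq_one (hp : p.Prime) (hp2 : p ≠ 2) (hp3 : p ≠ 3) (S : XiSetup 1 p) :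
    (Nat.card {c : ClassSet S.O // weight S.O c = 1} : ℚ) =
      ((p : ℚ) - 1) / 12 - (2 - (rho p 0 1 : ℚ)) / 4 - (2 - (rho p 1 1 : ℚ)) / 6 :=
  xiSetup_natCard_weight_eq_one brandtModule_massFormula_holds hp hp2 hp3 S

end Prime

end Literature.NumberTheory.Automorphic
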